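import Mathlib
import HarnessLib
import Summits.RiemannHypothesis.RiemannHypothesis.Theorems.DeBrangesSuzukiDoorDefs

/-!
# RiemannHypothesis / DeBrangesSuzukiDoor — crux `KernelSupport` (K3), stub `stub_vanishingGeneric`

Registered stub of the BC3 birth skeleton of `DeBrangesSuzukiDoor.KernelSupport`
(stmt-RiemannHypothesis-19727; planner rh-dbr-theory g4, `KernelSupport_line_birth.lean` sha16 6b04a5da75418a33),
proved BY NAME with the registered signature (namespace `…Cruxes.KernelSupport.Birth`, `invFL` from the Defs file):

generic Paley–Wiener vanishing — if `Φ` satisfies `‖Φ(u+ib)‖ ≤ C(1+|u|)^{-r}` on every line `b ≥ 1` with `r > 1`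
and the inverse transforms `invFL Φ b x` do not depend on `b ≥ 1`, then `invFL Φ 1 x = 0` for `x < 0`.
Proof: `‖invFL Φ b x‖ ≤ (2π)⁻¹ e^{bx} ∫‖Φ(u+ib)‖du ≤ (2π)⁻¹ C M e^{bx}` with `M = ∫(1+|u|)^{-r} < ∞`
(`integrable_one_add_norm`), and `e^{bx} → 0` as `b → ∞` when `x < 0`, while the left side is `‖invFL Φ 1 x‖`.
RH-FREE (pure analysis); nothing here bears on the truth of RH.
-/

noncomputable section

-- D-0017: `Summit.<S>.<S>.…` is the designed namespace of a single-problem summit.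
set_option linter.dupNamespace false

open MeasureTheory Complex Filter Topology

namespace Summit.RiemannHypothesis.RiemannHypothesis.Cruxes.KernelSupport.Birth

/-- `Re (-i(u+ic)x) = c x` (real `u, c, x`). -/
lemma re_neg_I_line_mul (c x u : ℝ) :
    (-Complex.I * ((u : ℂ) + (c : ℂ) * Complex.I) * (x : ℂ)).re = c * x := by
  simp only [Complex.mul_re, Complex.mul_im, Complex.neg_re, Complex.neg_im, Complex.add_re,
    Complex.add_im, Complex.I_re, Complex.I_im, Complex.ofReal_re, Complex.ofReal_im]
  ring

/-- `‖invFL Φ c x‖ ≤ (1/2π) e^{cx} ∫ ‖Φ(u+ic)‖ du` (unconditional; both sides junk-compatible). -/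
lemma norm_invFL_le (Φ : ℂ → ℂ) (c x : ℝ) :
    ‖invFL Φ c x‖ ≤ 1 / (2 * Real.pi) * Real.exp (c * x) * ∫ u : ℝ, ‖Φ ((u : ℂ) + (c : ℂ) * Complex.I)‖ := by
  unfold invFL
  have hn : ‖(1 : ℂ) / (2 * (Real.pi : ℂ))‖ = 1 / (2 * Real.pi) := by
    rw [norm_div, norm_mul, norm_one, Complex.norm_real, Complex.norm_two, Real.norm_eq_abs,
      abs_of_pos Real.pi_pos]
  rw [norm_mul, hn]
  have h1 : ‖∫ u : ℝ, Φ ((u : ℂ) + (c : ℂ) * Complex.I) *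
        Complex.exp (-Complex.I * ((u : ℂ) + (c : ℂ) * Complex.I) * (x : ℂ))‖
      ≤ ∫ u : ℝ, ‖Φ ((u : ℂ) + (c : ℂ) * Complex.I)‖ * Real.exp (c * x) := by
    refine (norm_integral_le_integral_norm _).trans (le_of_eq ?_)
    congr 1
    funext u
    rw [norm_mul, Complex.norm_exp, re_neg_I_line_mul]
  rw [integral_mul_const] at h1
  have hπ : 0 ≤ 1 / (2 * Real.pi) := by positivity
  calc 1 / (2 * Real.pi) * ‖∫ u : ℝ, Φ ((u : ℂ) + (c : ℂ) * Complex.I) *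
          Complex.exp (-Complex.I * ((u : ℂ) + (c : ℂ) * Complex.I) * (x : ℂ))‖
      ≤ 1 / (2 * Real.pi) * ((∫ u : ℝ, ‖Φ ((u : ℂ) + (c : ℂ) * Complex.I)‖) * Real.exp (c * x)) := by
        gcongr
    _ = 1 / (2 * Real.pi) * Real.exp (c * x) * ∫ u : ℝ, ‖Φ ((u : ℂ) + (c : ℂ) * Complex.I)‖ := by ring

/-- **Registered stub `stub_vanishingGeneric` of crux `KernelSupport` (PROVED, RH-FREE).** Uniform polynomial
decay of order `r > 1` on all lines `Im z = b ≥ 1` plus line independence force the inverse transform to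
vanish on `x < 0`. -/
theorem stub_vanishingGeneric : ∀ (Φ : ℂ → ℂ) (C r : ℝ), 1 < r →
    (∀ b : ℝ, 1 ≤ b → ∀ u : ℝ, ‖Φ ((u : ℂ) + (b : ℂ) * Complex.I)‖ ≤ C * (1 + |u|) ^ (-r)) →
    (∀ b : ℝ, 1 ≤ b → ∀ x : ℝ, invFL Φ b x = invFL Φ 1 x) →
    ∀ x : ℝ, x < 0 → invFL Φ 1 x = 0 := by
  intro Φ C r hr hdec hind x hx
  have hint : Integrable (fun u : ℝ => (1 + ‖u‖) ^ (-r)) :=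
    integrable_one_add_norm (E := ℝ) (μ := volume) (r := r) (by simpa using hr)
  set M : ℝ := ∫ u : ℝ, (1 + ‖u‖) ^ (-r) with hM
  -- for every b ≥ 1: ‖invFL Φ 1 x‖ ≤ (1/2π) e^{bx} (C M)
  have hbound : ∀ b : ℝ, 1 ≤ b → ‖invFL Φ 1 x‖ ≤ 1 / (2 * Real.pi) * Real.exp (b * x) * (C * M) := by
    intro b hb
    rw [← hind b hb x]
    have h1 := norm_invFL_le Φ b x
    have h2 : ∫ u : ℝ, ‖Φ ((u : ℂ) + (b : ℂ) * Complex.I)‖ ≤ ∫ u : ℝ, C * (1 + ‖u‖) ^ (-r) := by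
      refine integral_mono_of_nonneg (Eventually.of_forall fun u => norm_nonneg _) (hint.const_mul C)
        (Eventually.of_forall fun u => ?_)
      have h := hdec b hb u
      simpa [Real.norm_eq_abs] using h
    rw [integral_const_mul] at h2
    have hπ : 0 ≤ 1 / (2 * Real.pi) * Real.exp (b * x) := by positivity
    exact h1.trans (mul_le_mul_of_nonneg_left h2 hπ)
  -- the right-hand side tends to 0 as b → ∞ (x < 0)
  have hlim : Tendsto (fun b : ℝ => 1 / (2 * Real.pi) * Real.exp (b * x) * (C * M)) atTop
      (𝓝 (1 / (2 * Real.pi) * 0 * (C * M))) := by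
    have h := Real.tendsto_exp_atBot.comp (tendsto_id.atTop_mul_const_of_neg hx)
    exact (h.const_mul _).mul_const _
  rw [mul_zero, zero_mul] at hlim
  have hle : ‖invFL Φ 1 x‖ ≤ 0 :=
    ge_of_tendsto hlim (Filter.eventually_atTop.2 ⟨1, fun b hb => hbound b hb⟩)
  exact norm_le_zero_iff.1 hle

end Summit.RiemannHypothesis.RiemannHypothesis.Cruxes.KernelSupport.Birth

end
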